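import Summits.CriticalPhenomena.PercolationContinuityZ3.Theorems.PercNearOneGluingNoHeavyLowerTailChampionStability
import Literature.Probability.LatticeModels.ProdBernoulliIndependence
import HarnessLib

/-!
# `NoHeavyLowerTail` (stmt-CriticalPhenomena-4575) — two-port peeling: redundant sure pairs and sure paths

Route `PercNearOneGluingNoHeavy`, seat `prim-gen-swap` (gen 5); memo TWO-PORT-PEELING.md §5a.  Bookkeeping for the MS-STAR₂₂ assembly:
* `TwoPortPeeling.real_not_reachable_eq_zero_of_sure_path2/3` — if consecutive pairs `x–p(–q)–y` have weight `1`, then `x ↔ y` almost surely;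
* `TwoPortPeeling.real_count_update_one_eq_of_ae_reachable` — if `x ↔ y` almost surely with the pair `s(x,y)` closed, then raising `s(x,y)` to
  `1` does not change the law of any relay count: `μ_{W[s(x,y)↦1]}(P(|π(z)|)) = μ_{W[s(x,y)↦0]}(P(|π(z)|))`.
`μ_W = prodBernoulli W` on `Fin n`, relays `A`, `π(z) = {t ∈ A : z ↔ t}`.  No definitions, no named facts, no sorries.
-/

noncomputable section

namespace Summit.CriticalPhenomena.PercolationContinuityZ3.Theorems

open MeasureTheory Set Literature.Probability.LatticeModels Literature.Probability.Percolation
open scoped Classical BigOperators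

variable {n : ℕ}

namespace TwoPortPeeling

/-- A pair of weight `1` is almost surely open. [folklore] -/
theorem real_notMem_eq_zero_of_one (W : Sym2 (Fin n) → unitInterval) (e : Sym2 (Fin n)) (h : W e = 1) :
    (prodBernoulli W).real {ω : BondConfig (Fin n) | e ∉ ω} = 0 := by
  rw [prodBernoulli_real_setOf_notMem W e, h]; simp

/-- **Sure path of length two.**  If `W s(x,p) = W s(p,y) = 1` (`x ≠ p`, `p ≠ y`), then `x ↔ y` almost surely. [folklore] -/
theorem real_not_reachable_eq_zero_of_sure_path2 (W : Sym2 (Fin n) → unitInterval) (x p y : Fin n)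
    (hxp : x ≠ p) (hpy : p ≠ y) (h1 : W s(x, p) = 1) (h2 : W s(p, y) = 1) :
    (prodBernoulli W).real {ω : BondConfig (Fin n) | ω ∉ openConn x y} = 0 := by
  have hsub : {ω : BondConfig (Fin n) | ω ∉ openConn x y} ⊆
      {ω : BondConfig (Fin n) | s(x, p) ∉ ω} ∪ {ω : BondConfig (Fin n) | s(p, y) ∉ ω} := by
    intro ω hω
    by_contra hnot
    simp only [mem_union, mem_setOf_eq, not_or, not_not] at hnot
    apply hω
    have h1' : (openGraph ω).Adj x p := by rw [openGraph_adj]; exact ⟨hnot.1, hxp⟩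
    have h2' : (openGraph ω).Adj p y := by rw [openGraph_adj]; exact ⟨hnot.2, hpy⟩
    exact h1'.reachable.trans h2'.reachable
  refine le_antisymm ((measureReal_mono hsub).trans ((measureReal_union_le _ _).trans ?_)) measureReal_nonneg
  rw [real_notMem_eq_zero_of_one W _ h1, real_notMem_eq_zero_of_one W _ h2, add_zero]

/-- **Sure path of length three.**  If `W s(x,p) = W s(p,q) = W s(q,y) = 1` (consecutive vertices distinct), then `x ↔ y` almost surely.
[folklore] -/
theorem real_not_reachable_eq_zero_of_sure_path3 (W : Sym2 (Fin n) → unitInterval) (x p q y : Fin n)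
    (hxp : x ≠ p) (hpq : p ≠ q) (hqy : q ≠ y) (h1 : W s(x, p) = 1) (h2 : W s(p, q) = 1) (h3 : W s(q, y) = 1) :
    (prodBernoulli W).real {ω : BondConfig (Fin n) | ω ∉ openConn x y} = 0 := by
  have hsub : {ω : BondConfig (Fin n) | ω ∉ openConn x y} ⊆
      ({ω : BondConfig (Fin n) | s(x, p) ∉ ω} ∪ {ω : BondConfig (Fin n) | s(p, q) ∉ ω}) ∪
        {ω : BondConfig (Fin n) | s(q, y) ∉ ω} := by
    intro ω hω
    by_contra hnot
    simp only [mem_union, mem_setOf_eq, not_or, not_not] at hnot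
    apply hω
    have h1' : (openGraph ω).Adj x p := by rw [openGraph_adj]; exact ⟨hnot.1.1, hxp⟩
    have h2' : (openGraph ω).Adj p q := by rw [openGraph_adj]; exact ⟨hnot.1.2, hpq⟩
    have h3' : (openGraph ω).Adj q y := by rw [openGraph_adj]; exact ⟨hnot.2, hqy⟩
    exact (h1'.reachable.trans h2'.reachable).trans h3'.reachable
  refine le_antisymm ((measureReal_mono hsub).trans ((measureReal_union_le _ _).trans ?_)) measureReal_nonneg
  have h12 : (prodBernoulli W).real ({ω : BondConfig (Fin n) | s(x, p) ∉ ω} ∪ {ω : BondConfig (Fin n) | s(p, q) ∉ ω}) ≤ 0 := by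
    refine (measureReal_union_le _ _).trans ?_
    rw [real_notMem_eq_zero_of_one W _ h1, real_notMem_eq_zero_of_one W _ h2, add_zero]
  rw [real_notMem_eq_zero_of_one W _ h3, add_zero]
  exact le_antisymm h12 measureReal_nonneg |>.le

open ChampionStability in
/-- **A redundant sure pair does not change relay counts.**  If, with the pair `s(x,y)` (`x ≠ y`) closed, `x ↔ y` almost surely, then
`μ_{W[s(x,y)↦1]}(P(|π(z)|)) = μ_{W[s(x,y)↦0]}(P(|π(z)|))` for every vertex `z` and predicate `P`. [folklore] -/
theorem real_count_update_one_eq_of_ae_reachable (W : Sym2 (Fin n) → unitInterval) (A : Finset (Fin n)) {x y : Fin n}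
    (z : Fin n) (P : ℕ → Prop) (hxy : x ≠ y)
    (hnull : (prodBernoulli (Function.update W s(x, y) 0)).real {ω : BondConfig (Fin n) | ω ∉ openConn x y} = 0) :
    (prodBernoulli (Function.update W s(x, y) 1)).real
        {ω : BondConfig (Fin n) | P (A.filter fun t => ω ∈ openConn z t).card} =
      (prodBernoulli (Function.update W s(x, y) 0)).real
        {ω : BondConfig (Fin n) | P (A.filter fun t => ω ∈ openConn z t).card} := by
  set W0 := Function.update W s(x, y) 0 with hW0
  have h10 : Function.update W s(x, y) 1 = Function.update W0 s(x, y) 1 := by rw [hW0, Function.update_idem]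
  have hW0e : W0 s(x, y) = 0 := by rw [hW0, Function.update_self]
  rw [h10, real_update_one_eq W0 hW0e]
  apply measureReal_congr
  set Z : Set (BondConfig (Fin n)) := {ω | ω ∉ openConn x y} with hZ
  have hZ0 : prodBernoulli W0 Z = 0 := by
    have h := hnull
    rw [measureReal_def, ENNReal.toReal_eq_zero_iff] at h
    exact h.resolve_right (measure_ne_top _ _)
  have hagree : ∀ ω, ω ∉ Z →
      (ω ∈ (fun ω : BondConfig (Fin n) => insert s(x, y) ω) ⁻¹'
          {ω : BondConfig (Fin n) | P (A.filter fun t => ω ∈ openConn z t).card} ↔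
        ω ∈ {ω : BondConfig (Fin n) | P (A.filter fun t => ω ∈ openConn z t).card}) := by
    intro ω hω
    have hxy' : (openGraph ω).Reachable x y := by
      simp only [hZ, mem_setOf_eq, not_not] at hω; exact hω
    simp only [mem_preimage, mem_setOf_eq]
    have hfilt : (A.filter fun t => insert s(x, y) ω ∈ openConn z t) = (A.filter fun t => ω ∈ openConn z t) := by
      refine Finset.filter_congr fun t _ => ?_
      rw [show (insert s(x, y) ω ∈ openConn z t) = (openGraph (insert s(x, y) ω)).Reachable z t from rfl,
        reachable_insert_iff ω hxy z t]
      constructor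
      · rintro (h | ⟨⟨s₁, hs₁, h₁⟩, ⟨s₂, hs₂, h₂⟩⟩)
        · exact h
        · simp only [Finset.mem_insert, Finset.mem_singleton] at hs₁ hs₂
          have hto : (openGraph ω).Reachable s₁ s₂ := by
            rcases hs₁ with rfl | rfl <;> rcases hs₂ with rfl | rfl
            · exact SimpleGraph.Reachable.refl _
            · exact hxy'
            · exact hxy'.symm
            · exact SimpleGraph.Reachable.refl _
          exact (h₁.trans hto).trans h₂
      · exact fun h => Or.inl h
    rw [hfilt]
  refine ae_eq_set.2 ⟨measure_mono_null (fun ω hω => ?_) hZ0, measure_mono_null (fun ω hω => ?_) hZ0⟩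
  · by_contra hZ'
    exact hω.2 ((hagree ω hZ').1 hω.1)
  · by_contra hZ'
    exact hω.2 ((hagree ω hZ').2 hω.1)

end TwoPortPeeling

end Summit.CriticalPhenomena.PercolationContinuityZ3.Theorems

end
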